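import Summits.Ventures.PercRepro.RankLevelSetTheoremC
import Summits.Ventures.PercRepro.RankLevelSetFrameQM

/-!
# PercRepro — THEOREM C for ALL matroids: C-025 at bounded corank `|E| − p ≤ D` and large rank (night-1, gen 0)

`exists_N₀_c025_simple` (`RankLevelSetTheoremC`) is Theorem C of `proofs/NIGHT-1-C025-induction.md` §10 in its SIMPLE-CORE
form: for `q ≥ 2` and a corank `d ≥ q + 1` there is `N₀` with `Φ(p, q)·#U ≤ #Y` for every simple matroid of rank `p ≥ q + 2`,
corank `d` and at least `N₀` elements. This file removes «simple, rank exactly `p`, corank exactly `d`»: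

* **`three_le_encard_of_circuit`** — without loops or parallel pairs every circuit has `≥ 3` elements;
* **`rls_succ_bounded`** — the single-element reduction at level `q + 1` RESTRICTED to `|E| ≤ p + D` and `p ≥ P`: loops
  (`RLS_of_loop_q`) and parallel pairs (`RLS_of_parallel_q`, with level `q` for `M ／ e` at rank `p − 1`) are removed by
  strong induction on `|E|` (both keep `p`, so the threshold is on `p`, not on `|E|`); a simple matroid of rank `< p` has
  `U = ∅`, of rank `> p` is truncated to rank `p` (Theorem K, `rls_of_truncate`; the truncation is simple and has corank
  `|E| − p ≤ D`); a simple matroid of rank `p` has corank `|E| − p < q + 1` (`U = ∅`, `RLS_of_ncard_lt`), `= q + 1`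
  (Theorem M, `RLS_of_ncard_eq`) or `≥ q + 2` (Theorem C simple-core, with `N₀(q+1, d) ≤ P ≤ p ≤ |E|`);
* **`exists_P_c025_bounded`** — THEOREM C for all matroids: for every `q ≥ 2` and `D` there is `P` such that every finite
  matroid `M` and every `p ≥ max(P, q + 2)` with `|E| ≤ p + D` satisfy the body of `C025` at `(p, q)` (induction on `q`
  from `c025_two_all`, `P` the maximum of the level-`q` threshold `+ 1` and the `N₀(q+1, d)`, `d ≤ D`).
Axioms: standard.
-/

open scoped Matroid

namespace PercRepro

namespace ThmN

variable {α : Type}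

/-- Without loops and with every pair of rank `2`, every circuit has at least `3` elements. -/
theorem three_le_encard_of_circuit (M : Matroid α) [M.Finite]
    (hL : ∀ e ∈ M.E, ¬ M.IsLoop e) (hs : ∀ e ∈ M.E, ∀ f ∈ M.E, e ≠ f → M.eRk {e, f} = 2)
    (C : Set α) (hC : M.IsCircuit C) : 3 ≤ C.encard := by
  by_contra hlt
  push Not at hlt
  have hfin : C.Finite := M.ground_finite.subset hC.subset_ground
  rw [← hfin.cast_ncard_eq] at hlt
  have hlt' : C.ncard < 3 := by exact_mod_cast hlt
  have hpos : 0 < C.ncard := (Set.ncard_pos hfin).2 hC.nonempty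
  have hr := hC.eRk_add_one_eq
  rcases (show C.ncard = 1 ∨ C.ncard = 2 by omega) with h1 | h2
  · obtain ⟨e, rfl⟩ := Set.ncard_eq_one.1 h1
    have heE : e ∈ M.E := hC.subset_ground (Set.mem_singleton e)
    have hI : M.Indep {e} := _root_.Matroid.indep_singleton.2 ((_root_.Matroid.not_isLoop_iff heE).1 (hL e heE))
    rw [hI.eRk_eq_encard, Set.encard_singleton] at hr
    have : (1 + 1 : ℕ) = 1 := by exact_mod_cast hr
    omega
  · obtain ⟨e, f, hef, rfl⟩ := Set.ncard_eq_two.1 h2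
    have heE : e ∈ M.E := hC.subset_ground (Set.mem_insert e {f})
    have hfE : f ∈ M.E := hC.subset_ground (Set.mem_insert_of_mem e (Set.mem_singleton f))
    rw [hs e heE f hfE hef, Set.encard_pair hef] at hr
    have : (2 + 1 : ℕ) = 2 := by exact_mod_cast hr
    omega

/-- **The bounded-corank reduction at level `q + 1`**: from level `q` for all matroids with `P ≤ p` and `|E| ≤ p + D`
and from the simple-core statement at rank `p`, corank `q + 2 ≤ d ≤ D` and `P ≤ p`, the level `q + 1` for all matroids
with `P + 1 ≤ p` and `|E| ≤ p + D`. -/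
theorem rls_succ_bounded (q D P : ℕ)
    (hprev : ∀ (M : Matroid α) [M.Finite] (p : ℕ), P ≤ p → M.E.ncard ≤ p + D → q + 2 ≤ p → RLS M p q)
    (hcore : ∀ (M : Matroid α) [M.Finite] (p d : ℕ), P ≤ p → q + 2 ≤ d → d ≤ D →
      M.E.encard = M.eRank + d → M.eRank = (p : ℕ∞) → q + 3 ≤ p →
      (∀ C, M.IsCircuit C → 3 ≤ C.encard) → RLS M p (q + 1)) :
    ∀ (M : Matroid α) [M.Finite] (p : ℕ), P + 1 ≤ p → M.E.ncard ≤ p + D → q + 3 ≤ p → RLS M p (q + 1) := by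
  suffices H : ∀ n : ℕ, ∀ (M : Matroid α) [M.Finite], M.E.ncard = n → ∀ p : ℕ, P + 1 ≤ p → n ≤ p + D →
      q + 3 ≤ p → RLS M p (q + 1) from fun M _ p hP hD hp => H _ M rfl p hP hD hp
  intro n
  induction n using Nat.strong_induction_on with
  | _ n ih =>
  intro M _ hn p hP hD hp
  classical
  have hdel : ∀ e ∈ M.E, (M ＼ {e}).E.ncard < n ∧ (M ＼ {e}).E.ncard + 1 = n := by
    intro e he
    rw [_root_.Matroid.delete_ground, ← hn, ← Set.ncard_sdiff_singleton_add_one he M.ground_finite]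
    omega
  -- Case 1: a loop (same `p`, one element fewer)
  by_cases hL : ∃ e ∈ M.E, M.IsLoop e
  · obtain ⟨e, he, hloopE⟩ := hL
    exact RLS_of_loop_q M hloopE p (q + 1)
      (ih _ (hdel e he).1 (M ＼ {e}) rfl p hP (by have := (hdel e he).2; omega) hp)
  push Not at hL
  -- Case 2: a parallel pair (`M ＼ e` at the same `p`; `M ／ e` at level `q`, rank `p − 1`, corank unchanged)
  by_cases hPar : ∃ e ∈ M.E, ∃ e' ∈ M.E, e' ≠ e ∧ e ∈ M.closure {e'}
  · obtain ⟨e, he, e', he', hne, hpar⟩ := hPar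
    have heI : M.Indep {e} := _root_.Matroid.indep_singleton.2 ((_root_.Matroid.not_isLoop_iff he).1 (hL e he))
    obtain ⟨p', rfl⟩ : ∃ p', p = p' + 1 := ⟨p - 1, by omega⟩
    have hcon : (M ／ {e}).E.ncard ≤ p' + D := by
      rw [_root_.Matroid.contract_ground]
      rw [← Set.ncard_sdiff_singleton_add_one he M.ground_finite] at hn
      omega
    exact RLS_of_parallel_q M heI he' hne hpar
      (ih _ (hdel e he).1 (M ＼ {e}) rfl (p' + 1) hP (by have := (hdel e he).2; omega) hp)
      (hprev (M ／ {e}) p' (by omega) hcon (by omega))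
  push Not at hPar
  -- Case 3: simple
  have hs : ∀ e ∈ M.E, ∀ f ∈ M.E, e ≠ f → M.eRk {e, f} = 2 :=
    fun e he f hf hef => eRk_pair_eq_two_of_simple M hL (fun e he e' he' hne => hPar e he e' he' hne) he hf hef
  have hcirc := three_le_encard_of_circuit M hL hs
  -- the simple rank-`p` case, for `M` itself and for its truncation
  have hrank : ∀ (N : Matroid α) [N.Finite], N.E = M.E → N.eRank = (p : ℕ∞) →
      (∀ C, N.IsCircuit C → 3 ≤ C.encard) → RLS N p (q + 1) := by
    intro N _ hNE hNR hNc
    rcases lt_trichotomy N.E.ncard (p + (q + 1)) with hlt | heq | hgt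
    · exact RLS_of_ncard_lt N hlt
    · exact RLS_of_ncard_eq N heq
    · have hpn : p ≤ N.E.ncard := by omega
      refine hcore N p (N.E.ncard - p) (by omega) (by omega) (by rw [hNE, hn]; omega) ?_ hNR hp hNc
      rw [hNR, ← N.ground_finite.cast_ncard_eq]
      norm_cast
      omega
  rcases lt_trichotomy M.eRank (p : ℕ∞) with hlt | heq | hgt
  · exact RLS_of_eRank_lt M hlt
  · exact hrank M rfl heq hcirc
  · -- `r(E) > p`: truncate to rank `p` (same ground set; simple; rank `p`)
    have hp2 : 2 ≤ p := by omega
    set T := Matroid.truncate M p with hTdef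
    have hTs := truncate_pair_eRk M hp2 hs
    have hTR := truncate_eRank_eq M hgt
    have hTE : T.E = M.E := Matroid.truncate_ground M p
    have hTL : ∀ e ∈ T.E, ¬ T.IsLoop e := by
      intro e he hloop
      have heM : e ∈ M.E := hTE ▸ he
      have hI : T.Indep {e} := by
        rw [Matroid.truncate_indep_iff]
        refine ⟨_root_.Matroid.indep_singleton.2 ((_root_.Matroid.not_isLoop_iff heM).1 (hL e heM)), ?_⟩
        rw [Set.ncard_singleton]; omega
      exact ((_root_.Matroid.not_isLoop_iff he).2 (_root_.Matroid.indep_singleton.1 hI)) hloop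
    have hT : RLS T p (q + 1) := hrank T hTE hTR (three_le_encard_of_circuit T hTL hTs)
    unfold RLS at hT ⊢
    exact Matroid.rls_of_truncate M p (by omega) (phiK p (q + 1)) (by unfold phiK; positivity) hT

/-- **THEOREM C for all matroids** (C-025 at bounded corank and large rank): for every `q ≥ 2` and every `D` there is
a threshold `P` such that every finite matroid `M` and every `p ≥ P` with `q + 2 ≤ p` and `|E| ≤ p + D` satisfy
`Φ(p, q)·#U(p, q) ≤ #Y(p, q)`. -/
theorem exists_P_c025_bounded (q D : ℕ) (hq : 2 ≤ q) :
    ∃ P : ℕ, ∀ {α : Type} (M : Matroid α) [M.Finite] (p : ℕ), P ≤ p → M.E.ncard ≤ p + D → q + 2 ≤ p →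
      RLS M p q := by
  induction q with
  | zero => exact absurd hq (by omega)
  | succ q ihq =>
  rcases Nat.lt_or_ge q 2 with hq2 | hq2
  · -- `q + 1 = 2`: Theorem N at level `2`
    have hq1 : q = 1 := by omega
    subst hq1
    exact ⟨0, fun M _ p _ _ hp => c025_two_all M p (by omega)⟩
  · obtain ⟨P, hP⟩ := ihq hq2
    classical
    -- the simple-core thresholds `N₀(q + 1, d)` for `q + 2 ≤ d ≤ D`
    let N : ℕ → ℕ := fun d =>
      if h : q + 2 ≤ d then Classical.choose (exists_N₀_c025_simple (q + 1) d (by omega) (by omega)) else 0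
    have hN : ∀ d, q + 2 ≤ d → ∀ {α : Type} (M : Matroid α) [M.Finite] (p : ℕ),
        N d ≤ M.E.ncard → M.E.encard = M.eRank + d → M.eRank = (p : ℕ∞) → q + 1 + 2 ≤ p →
        (∀ C, M.IsCircuit C → 3 ≤ C.encard) →
        phiK p (q + 1) * (Matroid.topCount M p (q + 1) : ℚ) ≤ (Matroid.midCount M p (q + 1) : ℚ) := by
      intro d hd
      simp only [N, dif_pos hd]
      exact Classical.choose_spec (exists_N₀_c025_simple (q + 1) d (by omega) (by omega))
    refine ⟨max P ((Finset.range (D + 1)).sup N) + 1, ?_⟩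
    intro α M _ p hPp hD hp
    refine rls_succ_bounded q D (max P ((Finset.range (D + 1)).sup N)) ?_ ?_ M p (by omega) hD (by omega)
    · intro M' _ p' hP' hD' hp'
      exact hP M' p' (by omega) hD' hp'
    · intro M' _ p' d hP' hd hdD hEd hR hp' hc
      have hNd : N d ≤ (Finset.range (D + 1)).sup N := Finset.le_sup (Finset.mem_range.2 (by omega))
      have hpn : p' ≤ M'.E.ncard := by
        have h1 : M'.eRank ≤ M'.E.encard := by rw [M'.eRank_def]; exact M'.eRk_le_encard _
        rw [hR, ← M'.ground_finite.cast_ncard_eq] at h1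
        exact_mod_cast h1
      rw [RLS_iff]
      exact hN d hd M' p' (by omega) hEd hR (by omega) hc

end ThmN

end PercRepro
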